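import Mathlib
import Summits.Ventures.HodgeRepro.Tier4.Line1.RTFSetting
import Summits.Ventures.HodgeRepro.Tier4.Line1.RealisedSetting
import Summits.Ventures.HodgeRepro.Tier4.Line1.IsolatingTestsLevel
import Summits.Ventures.HodgeRepro.Tier4.Line1.IsolatingTestsDeepLevel
import Summits.Ventures.HodgeRepro.Tier4.Line1.LeftTypeOfMatrixCoeff
import Summits.Ventures.HodgeRepro.Tier4.Line1.ArchMatrixCoeff
import Summits.Ventures.HodgeRepro.Tier4.Line1.FinLevelCompact
import Summits.Ventures.HodgeRepro.Tier4.Line1.DoubleCosetIsolation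
import Summits.Ventures.HodgeRepro.Tier4.Line1.ArchDensityBiInvariant
import Summits.Ventures.HodgeRepro.Tier4.Line1.IsolatingTestsFiniteRankType
import Summits.Ventures.HodgeRepro.Tier4.Line1.TotallyDefiniteBridge

/-!
# Tier4/Line1/IsolatingTestsFiniteRankTypeBiInvariant — (S1b) ∧ F2′ IN ONE DEFINED BLOCK: the isolating pair of J2
with a first test of finite-rank left-`K_f(N) × G_∞`-type which is ALSO bi-`K(N)`-invariant

Blind re-derivation cell `pub-hodge-repro`, Tier 4 (README §9–§10), seat t4-L1-p4 (gen 4), LINE L1; t4-plan-1's cut (a)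
(S14297).  Target tree path `lean/Summits/Ventures/HodgeRepro/Tier4/Line1/IsolatingTestsFiniteRankTypeBiInvariant.lean`.
Imports this seat's IsolatingTestsFiniteRankType (the generic `Setting.exists_pair_orbital_ne_zero_of_approx`, the
double-coset lemmas), ArchDensityBiInvariant (`exists_finiteRankLeftType_approx_biInvariant_deep`), DoubleCosetIsolation
(F2‴) and TotallyDefiniteBridge (`isCompact_archImage_of_totallyDefinite`).  0 print.

WHAT IS PROVED.  **`exists_isolating_tests_finiteRankType_biInvariant`**: with `hC : IsCompact (archImage W)` there are a
level `N ≠ 0`, test functions `f₁ f₂` and one rational double coset `o₀` with `f₁ ⋆ f₂` a test function meeting exactly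
`o₀` on `DT × DT′`, a non-zero orbital term, `RTF.HasFiniteRankLeftType (finLevel W N) f₁` AND the two displayed
invariance clauses `∀ k ∈ levelK W N, ∀ x, f₁ (x * k) = f₁ x ∧ f₁ (k * x) = f₁ x` (the clause of
`defined_inputs_realisable_deepLevel`, p684914).  Same proof as `exists_isolating_tests_finiteRankType`: the generic
theorem with the shape predicate `P h := ∃ N ≠ 0, HasFiniteRankLeftType (finLevel W N) h ∧ bi-levelK W N-invariance`,
the density hypothesis from ArchDensityBiInvariant on the isolating double coset `K_{N₁} · {γ₀} · K_{N₁}` (bi-invariant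
under `finLevel W N₁`).  Then the DEFINED block `defined_inputs_realisable_finiteRankType_biInvariant` and the
`_of_totallyDefinite` twins.  RECORD (t4-plan-1 S14297): rows (4)+(5) and row (6) of L1's line table share ONE
DEFINED block — `f̄₁` lies in the `K(N)`-fixed block of row (6) and is of finite type for the open `finLevel W N` of
(S1b).  Nothing here says anything about the status of the Hodge conjecture for CM abelian varieties, which is NOT
proved (HC_CM is NOT proved by anyone in this repository).
-/

set_option autoImplicit false

noncomputable section

namespace Summit.Ventures.HodgeRepro.Tier4.Line1

open MeasureTheory Topology NumberField Common
open scoped Pointwise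

section Instance

variable {k : Type} [Field k] [NumberField k] (W : PlaneData k) [MeasurableSpace (GA W)] [BorelSpace (GA W)]
  (hW : IsDefinite W) (hg : IsGenuineRow W) (R : RTFData W) (μ : Measure (GA W)) [μ.IsHaarMeasure]
  [R.μT.IsHaarMeasure] [R.μT'.IsHaarMeasure] (hT : IsCompact (closure R.DT)) (hT' : IsCompact (closure R.DT'))

/-- **(S1b) ∧ F2′ in one block**: J2's isolating pair with `f₁` of finite-rank left-`finLevel W N`-type AND
bi-`levelK W N`-invariant, under `hC : IsCompact (archImage W)`. -/
theorem exists_isolating_tests_finiteRankType_biInvariant (hC : IsCompact (archImage W)) (hc : Continuous R.chi)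
    (hu : ∀ a, ‖R.chi a‖ = 1) (hc' : Continuous R.chi') (hu' : ∀ a, ‖R.chi' a‖ = 1) :
    ∃ (N : ℕ) (f₁ f₂ : GA W → ℂ) (o₀ : (Setting.ofAdelic W hW hg R μ hT hT').Orbit), N ≠ 0 ∧
      RTF.IsTest f₁ ∧ RTF.IsTest f₂ ∧ RTF.IsTest ((Setting.ofAdelic W hW hg R μ hT hT').conv f₁ f₂) ∧
      (Setting.ofAdelic W hW hg R μ hT hT').geoSupport ((Setting.ofAdelic W hW hg R μ hT hT').conv f₁ f₂) = {o₀} ∧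
      (Setting.ofAdelic W hW hg R μ hT hT').orbital R.chi R.chi' o₀
        ((Setting.ofAdelic W hW hg R μ hT hT').conv f₁ f₂) ≠ 0 ∧
      RTF.HasFiniteRankLeftType (finLevel W N) f₁ ∧
      ∀ k ∈ levelK W N, ∀ x, f₁ (x * k) = f₁ x ∧ f₁ (k * x) = f₁ x := by
  haveI : Countable (Setting.ofAdelic W hW hg R μ hT hT').Gk := rationalPoints_countable W
  haveI : T2Space (GA W) := t2Space_GA W
  haveI : LocallyCompactSpace (GA W) := locallyCompact_GA W
  obtain ⟨γ₀, hreg⟩ := exists_regular_rational W hW hg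
  have hreg' : IsRegularRational W γ₀ := isRegularRational_of_isLinRegular W γ₀ hreg
  -- the isolating double coset, bi-invariant under `finLevel W N₁`
  obtain ⟨N₁, hN₁, hiso⟩ := exists_level_isolating_doubleCoset W hW hg R μ hT hT' hC γ₀ hreg
  have hKc : IsCompact (finLevel W N₁ : Set (GA W)) := isCompact_finLevel W hC hN₁
  have hKo : IsOpen (finLevel W N₁ : Set (GA W)) := isOpen_finLevel W hN₁
  have hXc : IsCompact ((finLevel W N₁ : Set (GA W)) * {(γ₀ : GA W)} * (finLevel W N₁ : Set (GA W))) :=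
    isCompact_doubleCoset₂ (finLevel W N₁) (finLevel W N₁) hKc hKc _
  have hXo : IsOpen ((finLevel W N₁ : Set (GA W)) * {(γ₀ : GA W)} * (finLevel W N₁ : Set (GA W))) :=
    isOpen_doubleCoset₂ (finLevel W N₁) (finLevel W N₁) hKo _
  have hγX : (γ₀ : GA W) ∈ (finLevel W N₁ : Set (GA W)) * {(γ₀ : GA W)} * (finLevel W N₁ : Set (GA W)) :=
    mem_doubleCoset₂_self (finLevel W N₁) (finLevel W N₁) _
  have hKX : ∀ k ∈ finLevel W N₁, ∀ g,
      k * g ∈ (finLevel W N₁ : Set (GA W)) * {(γ₀ : GA W)} * (finLevel W N₁ : Set (GA W)) ↔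
        g ∈ (finLevel W N₁ : Set (GA W)) * {(γ₀ : GA W)} * (finLevel W N₁ : Set (GA W)) :=
    fun k hk g => doubleCoset₂_left_invariant (finLevel W N₁) (finLevel W N₁) hk _ g
  have hXK : ∀ k ∈ finLevel W N₁, ∀ g,
      g * k ∈ (finLevel W N₁ : Set (GA W)) * {(γ₀ : GA W)} * (finLevel W N₁ : Set (GA W)) ↔
        g ∈ (finLevel W N₁ : Set (GA W)) * {(γ₀ : GA W)} * (finLevel W N₁ : Set (GA W)) :=
    fun k hk g => doubleCoset₂_right_invariant (finLevel W N₁) (finLevel W N₁) hk _ g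
  -- the density hypothesis for the shape «finite-rank type ∧ bi-invariant at one level»
  have hdense : ∀ f₀ : GA W → ℂ, RTF.IsTest f₀ →
      (∀ g, g ∉ (finLevel W N₁ : Set (GA W)) * {(γ₀ : GA W)} * (finLevel W N₁ : Set (GA W)) → f₀ g = 0) →
      ∀ η : ℝ, 0 < η → ∃ h : GA W → ℂ, RTF.IsTest h ∧
        (∀ g, g ∉ (finLevel W N₁ : Set (GA W)) * {(γ₀ : GA W)} * (finLevel W N₁ : Set (GA W)) → h g = 0) ∧
        (∃ N : ℕ, N ≠ 0 ∧ RTF.HasFiniteRankLeftType (finLevel W N) h ∧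
          ∀ k ∈ levelK W N, ∀ x, h (x * k) = h x ∧ h (k * x) = h x) ∧
        ∀ g, ‖h g - f₀ g‖ ≤ η := by
    intro f₀ h₀ hf₀ η hη
    obtain ⟨N, hN, h, hht, hhX, hhtype, hhinv, hhclose⟩ :=
      exists_finiteRankLeftType_approx_biInvariant_deep W hC hN₁ hXc hXo hKX hXK h₀ hf₀ hη
    exact ⟨h, hht, hhX, ⟨N, hN, hhtype, hhinv⟩, hhclose⟩
  obtain ⟨f₁, f₂, h₁, h₂, hconv, hsupp, hne, N, hN, htype, hinv⟩ :=
    (Setting.ofAdelic W hW hg R μ hT hT').exists_pair_orbital_ne_zero_of_approx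
      (isCharacter_ofAdelic W hW hg R μ hT hT' hc hu) (isCharacter'_ofAdelic W hW hg R μ hT hT' hc' hu')
      (centralMatch_ofAdelic W hW hg R μ hT hT') γ₀ hreg' hXo hXc hγX _ hdense
  refine ⟨N, f₁, f₂, (Setting.ofAdelic W hW hg R μ hT hT').orbitOf γ₀, hN, h₁, h₂, hconv, ?_, hne, htype, hinv⟩
  ext o
  constructor
  · rintro ⟨t, ht, t', ht', γ, rfl, hγne⟩
    exact hiso t (subset_closure ht) t' (subset_closure ht') γ
      (hsupp (subset_tsupport _ (Function.mem_support.mpr hγne)))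
  · intro ho
    rw [Set.mem_singleton_iff] at ho
    subst ho
    by_contra h
    exact hne ((Setting.ofAdelic W hW hg R μ hT hT').orbital_eq_zero_of_not_mem R.chi R.chi' h)

/-- **The DEFINED block of the residual, (S1b) shape AND F2′ at the same level**: an adapted ONB `(τ, φ, n)` and an
isolating pair `(f₁, f₂, o₀)` at a level `N ≠ 0` with `f₁` of finite-rank left-`finLevel W N`-type and
bi-`levelK W N`-invariant. -/
theorem defined_inputs_realisable_finiteRankType_biInvariant (hC : IsCompact (archImage W)) (hc : Continuous R.chi)
    (hu : ∀ a, ‖R.chi a‖ = 1) (hc' : Continuous R.chi') (hu' : ∀ a, ‖R.chi' a‖ = 1) :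
    ∃ (τ : ℕ → Set (GA W → ℂ)) (φ : ℕ → GA W → ℂ) (n : ℕ → ℕ),
      (Setting.ofAdelic W hW hg R μ hT hT').IsAdaptedONB τ φ n ∧
      ∃ (N : ℕ) (f₁ f₂ : GA W → ℂ) (o₀ : (Setting.ofAdelic W hW hg R μ hT hT').Orbit), N ≠ 0 ∧
        RTF.IsTest f₁ ∧ RTF.IsTest f₂ ∧ RTF.IsTest ((Setting.ofAdelic W hW hg R μ hT hT').conv f₁ f₂) ∧
        (Setting.ofAdelic W hW hg R μ hT hT').geoSupport ((Setting.ofAdelic W hW hg R μ hT hT').conv f₁ f₂) = {o₀} ∧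
        (Setting.ofAdelic W hW hg R μ hT hT').orbital R.chi R.chi' o₀
          ((Setting.ofAdelic W hW hg R μ hT hT').conv f₁ f₂) ≠ 0 ∧
        RTF.HasFiniteRankLeftType (finLevel W N) f₁ ∧
        ∀ k ∈ levelK W N, ∀ x, f₁ (x * k) = f₁ x ∧ f₁ (k * x) = f₁ x := by
  obtain ⟨τ, φ, n, hB⟩ := exists_adaptedONB W hW hg R μ hT hT'
  exact ⟨τ, φ, n, hB, exists_isolating_tests_finiteRankType_biInvariant W hW hg R μ hT hT' hC hc hu hc' hu'⟩

/-- the bi-invariant (S1b) ∧ F2′ pair with `IsTotallyDefinite W` displayed. -/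
theorem exists_isolating_tests_finiteRankType_biInvariant_of_totallyDefinite (htot : IsTotallyDefinite W)
    (hc : Continuous R.chi) (hu : ∀ a, ‖R.chi a‖ = 1) (hc' : Continuous R.chi') (hu' : ∀ a, ‖R.chi' a‖ = 1) :
    ∃ (N : ℕ) (f₁ f₂ : GA W → ℂ) (o₀ : (Setting.ofAdelic W hW hg R μ hT hT').Orbit), N ≠ 0 ∧
      RTF.IsTest f₁ ∧ RTF.IsTest f₂ ∧ RTF.IsTest ((Setting.ofAdelic W hW hg R μ hT hT').conv f₁ f₂) ∧
      (Setting.ofAdelic W hW hg R μ hT hT').geoSupport ((Setting.ofAdelic W hW hg R μ hT hT').conv f₁ f₂) = {o₀} ∧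
      (Setting.ofAdelic W hW hg R μ hT hT').orbital R.chi R.chi' o₀
        ((Setting.ofAdelic W hW hg R μ hT hT').conv f₁ f₂) ≠ 0 ∧
      RTF.HasFiniteRankLeftType (finLevel W N) f₁ ∧
      ∀ k ∈ levelK W N, ∀ x, f₁ (x * k) = f₁ x ∧ f₁ (k * x) = f₁ x :=
  exists_isolating_tests_finiteRankType_biInvariant W hW hg R μ hT hT'
    (isCompact_archImage_of_totallyDefinite W htot) hc hu hc' hu'

/-- the DEFINED block, (S1b) shape AND F2′, with `IsTotallyDefinite W` displayed. -/
theorem defined_inputs_realisable_finiteRankType_biInvariant_of_totallyDefinite (htot : IsTotallyDefinite W)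
    (hc : Continuous R.chi) (hu : ∀ a, ‖R.chi a‖ = 1) (hc' : Continuous R.chi') (hu' : ∀ a, ‖R.chi' a‖ = 1) :
    ∃ (τ : ℕ → Set (GA W → ℂ)) (φ : ℕ → GA W → ℂ) (n : ℕ → ℕ),
      (Setting.ofAdelic W hW hg R μ hT hT').IsAdaptedONB τ φ n ∧
      ∃ (N : ℕ) (f₁ f₂ : GA W → ℂ) (o₀ : (Setting.ofAdelic W hW hg R μ hT hT').Orbit), N ≠ 0 ∧
        RTF.IsTest f₁ ∧ RTF.IsTest f₂ ∧ RTF.IsTest ((Setting.ofAdelic W hW hg R μ hT hT').conv f₁ f₂) ∧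
        (Setting.ofAdelic W hW hg R μ hT hT').geoSupport ((Setting.ofAdelic W hW hg R μ hT hT').conv f₁ f₂) = {o₀} ∧
        (Setting.ofAdelic W hW hg R μ hT hT').orbital R.chi R.chi' o₀
          ((Setting.ofAdelic W hW hg R μ hT hT').conv f₁ f₂) ≠ 0 ∧
        RTF.HasFiniteRankLeftType (finLevel W N) f₁ ∧
        ∀ k ∈ levelK W N, ∀ x, f₁ (x * k) = f₁ x ∧ f₁ (k * x) = f₁ x :=
  defined_inputs_realisable_finiteRankType_biInvariant W hW hg R μ hT hT'
    (isCompact_archImage_of_totallyDefinite W htot) hc hu hc' hu'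

end Instance

end Summit.Ventures.HodgeRepro.Tier4.Line1

end
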